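import Mathlib
import Literature.Combinatorics.Additive.TripleProductProperty
import Summits.MatrixMultiplication.MatrixMultiplication.Theorems.GroupTheoreticSTPPCThesisProp52PairMaximal

/-!
# Fat partners of the axes triple in `(ℤ/n)³`: the seven constraints on a partner

Support file for route `MatrixMultiplication/GroupTheoreticSTPP` (target `CThesis`, stmt-MatrixMultiplication-0593),
cell `mm-stpp` (D-0046), theory statement S9 («fat-partner rigidity», HOME/mm-stpp-theory/FAT-PARTNERS.md).
Host `H = (ℤ/n)³` (`Fin 3 → ZMod n`); `P_k` the punctured axes; a two-member family indexed by `Fin 2`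
whose member `0` is the axes triple `(P₀, P₁, P₂)` (membership hypotheses) and whose member `1` is an
ARBITRARY triple `(A 1, B 1, C 1)`.  If the family has the simultaneous triple product property
(additive CKSU Def. 5.1), the eight index patterns of clause (ii)/(i) unpack into exactly seven constraints
on member `1` (here `N₀ = {(0,y,z) : yz ≠ 0}`, `N₁ = {(x,0,z) : xz ≠ 0}`, `N₂ = {(x,y,0) : xy ≠ 0}`):

* `fAB`, `fBC`, `fCA` (patterns `(0,1,0)`, `(0,0,1)`, `(1,0,0)`): `a₀ = b₀ ∨ a₁ = b₁`, `b₁ = c₁ ∨ b₂ = c₂`,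
  `c₀ = a₀ ∨ c₂ = a₂` for all `a ∈ A 1, b ∈ B 1, c ∈ C 1`;
* `gA`, `gB`, `gC` (patterns `(1,1,0)`, `(0,1,1)`, `(1,0,1)`): `(A−A)+(B−C)` avoids `N₀`, `(B−B)+(C−A)`
  avoids `N₁`, `(C−C)+(A−B)` avoids `N₂`;
* `sum_injective` (pattern `(1,1,1)` = the TPP of member `1`): `(a,b,c) ↦ a+b+c` is injective.

These are exactly the hypotheses of the abstract, cyclically symmetric files `…FatPartnersLines*.lean`
(with `(X,Y,Z,p,q,r) = (A 1, B 1, C 1, 0, 1, 2)`, up to the order of two disjunctions), where the rigidity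
theorem is proved; the assembly is `…FatPartnersRigidity.lean`.

WHAT THIS IS NOT: any statement about fat members yet; nothing about `ω`.

## References
* H. Cohn, R. Kleinberg, B. Szegedy, C. Umans, FOCS 2005, Def. 5.1, Prop. 5.2.
-/

-- single-conjunct summit: the mandated namespace repeats `MatrixMultiplication`.
set_option linter.dupNamespace false

namespace Summit.MatrixMultiplication.MatrixMultiplication.Theorems

namespace FatPartners

open Finset Literature.Combinatorics.Additive

variable {n : ℕ} {A B C : Fin 2 → Finset (Fin 3 → ZMod n)}

/-! ### One more extraction lemma: two axes once each, third coordinate prescribed zero -/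

/-- If `w + x + y ≠ 0` for all `x ∈ P_α`, `y ∈ P_β` (punctured axes), then `w` is not of the form
`(w_α ≠ 0, w_β ≠ 0, w_γ = 0)`. [folklore] -/
theorem not_N_of_avoid₂ {α β γ : Fin 3} (hαβ : α ≠ β) (hαγ : α ≠ γ) (hβγ : β ≠ γ)
    (hcov : ∀ i : Fin 3, i = α ∨ i = β ∨ i = γ) {P Q : Finset (Fin 3 → ZMod n)}
    (hP : ∀ x, x ∈ P ↔ x α ≠ 0 ∧ ∀ j, j ≠ α → x j = 0)
    (hQ : ∀ x, x ∈ Q ↔ x β ≠ 0 ∧ ∀ j, j ≠ β → x j = 0) {w : Fin 3 → ZMod n}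
    (havoid : ∀ x ∈ P, ∀ y ∈ Q, w + x + y ≠ 0) : w α = 0 ∨ w β = 0 ∨ w γ ≠ 0 := by
  by_contra h
  simp only [not_or, not_not] at h
  obtain ⟨hα, hβ, hγ⟩ := h
  have hx : Pi.single α (-(w α)) ∈ P := by
    rw [hP]; exact ⟨by simp [hα], fun j hj => by simp [Pi.single_eq_of_ne hj]⟩
  have hy : Pi.single β (-(w β)) ∈ Q := by
    rw [hQ]; exact ⟨by simp [hβ], fun j hj => by simp [Pi.single_eq_of_ne hj]⟩
  refine havoid _ hx _ hy ?_
  funext i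
  simp only [Pi.add_apply, Pi.zero_apply]
  rcases hcov i with rfl | rfl | rfl
  · rw [Pi.single_eq_same, Pi.single_eq_of_ne hαβ]; ring
  · rw [Pi.single_eq_same, Pi.single_eq_of_ne (Ne.symm hαβ)]; ring
  · rw [Pi.single_eq_of_ne (Ne.symm hαγ), Pi.single_eq_of_ne (Ne.symm hβγ), hγ]; ring

/-! ### The seven constraints on a partner of the axes triple -/

section Constraints

variable (hn : 3 ≤ n)
  (hA0 : ∀ x, x ∈ A 0 ↔ x 0 ≠ 0 ∧ ∀ j, j ≠ 0 → x j = 0)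
  (hB0 : ∀ x, x ∈ B 0 ↔ x 1 ≠ 0 ∧ ∀ j, j ≠ 1 → x j = 0)
  (hC0 : ∀ x, x ∈ C 0 ↔ x 2 ≠ 0 ∧ ∀ j, j ≠ 2 → x j = 0)
  (hS : AddSimultaneousTPP A B C)
include hn hA0 hB0 hC0 hS

/-- Pattern `(0,1,0)`: `a₀ = b₀` or `a₁ = b₁` for `a ∈ A 1`, `b ∈ B 1`. [cite: CohnKleinbergSzegedyUmans2005, Def. 5.1] -/
theorem fAB {a b : Fin 3 → ZMod n} (ha : a ∈ A 1) (hb : b ∈ B 1) : a 0 = b 0 ∨ a 1 = b 1 := by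
  have h01 : (0 : Fin 2) ≠ 1 := by decide
  have key := Prop52Maximal.zero_or_zero_of_avoid₃ hn (α := 0) (β := 1) (γ := 2) (by decide)
    (by decide) (by decide) (by decide) hA0 hB0 hC0 (w := b - a)
    fun x hx y hy r hr r' hr' heq => h01 (hS.2 0 1 0 x hx a ha b hb (-y)
      (Prop52Maximal.neg_mem_axis hB0 hy) r hr (-r') (Prop52Maximal.neg_mem_axis hC0 hr')
      (by rw [← heq]; abel)).1
  rcases key with h | h
  · left; rw [Pi.sub_apply, sub_eq_zero] at h; exact h.symm
  · right; rw [Pi.sub_apply, sub_eq_zero] at h; exact h.symm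

/-- Pattern `(0,0,1)`: `b₁ = c₁` or `b₂ = c₂` for `b ∈ B 1`, `c ∈ C 1`. [cite: CohnKleinbergSzegedyUmans2005, Def. 5.1] -/
theorem fBC {b c : Fin 3 → ZMod n} (hb : b ∈ B 1) (hc : c ∈ C 1) : b 1 = c 1 ∨ b 2 = c 2 := by
  have h01 : (0 : Fin 2) ≠ 1 := by decide
  have key := Prop52Maximal.zero_or_zero_of_avoid₃ hn (α := 1) (β := 2) (γ := 0) (by decide)
    (by decide) (by decide) (by decide) hB0 hC0 hA0 (w := c - b)
    fun x hx y hy r hr r' hr' heq => h01 (hS.2 0 0 1 r hr (-r') (Prop52Maximal.neg_mem_axis hA0 hr')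
      x hx b hb c hc (-y) (Prop52Maximal.neg_mem_axis hC0 hy) (by rw [← heq]; abel)).2
  rcases key with h | h
  · left; rw [Pi.sub_apply, sub_eq_zero] at h; exact h.symm
  · right; rw [Pi.sub_apply, sub_eq_zero] at h; exact h.symm

/-- Pattern `(1,0,0)`: `c₀ = a₀` or `c₂ = a₂` for `c ∈ C 1`, `a ∈ A 1`. [cite: CohnKleinbergSzegedyUmans2005, Def. 5.1] -/
theorem fCA {c a : Fin 3 → ZMod n} (hc : c ∈ C 1) (ha : a ∈ A 1) : c 0 = a 0 ∨ c 2 = a 2 := by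
  have h01 : (0 : Fin 2) ≠ 1 := by decide
  have key := Prop52Maximal.zero_or_zero_of_avoid₃ hn (α := 0) (β := 2) (γ := 1) (by decide)
    (by decide) (by decide) (by decide) hA0 hC0 hB0 (w := a - c)
    fun x hx y hy r hr r' hr' heq => h01.symm (hS.2 1 0 0 a ha (-x)
      (Prop52Maximal.neg_mem_axis hA0 hx) r hr (-r') (Prop52Maximal.neg_mem_axis hB0 hr') y hy c hc
      (by rw [← heq]; abel)).1
  rcases key with h | h
  · left; rw [Pi.sub_apply, sub_eq_zero] at h; exact h.symm
  · right; rw [Pi.sub_apply, sub_eq_zero] at h; exact h.symm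

omit hn hA0 in
/-- Pattern `(1,1,0)`: `(a − a') + (b − c') ∉ N₀` for `a, a' ∈ A 1`, `b ∈ B 1`, `c' ∈ C 1`.
[cite: CohnKleinbergSzegedyUmans2005, Def. 5.1] -/
theorem gA {a a' b c' : Fin 3 → ZMod n} (ha : a ∈ A 1) (ha' : a' ∈ A 1) (hb : b ∈ B 1)
    (hc' : c' ∈ C 1) :
    (a - a' + (b - c')) 1 = 0 ∨ (a - a' + (b - c')) 2 = 0 ∨ (a - a' + (b - c')) 0 ≠ 0 := by
  have h10 : (1 : Fin 2) ≠ 0 := by decide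
  refine not_N_of_avoid₂ (α := 1) (β := 2) (γ := 0) (by decide) (by decide) (by decide) (by decide)
    hB0 hC0 fun y hy z hz heq => h10 ?_
  exact (hS.2 1 1 0 a ha a' ha' b hb (-y) (Prop52Maximal.neg_mem_axis hB0 hy) z hz c' hc'
    (by rw [← heq]; abel)).2

omit hn hB0 in
/-- Pattern `(0,1,1)`: `(b − b') + (c − a') ∉ N₁` for `b, b' ∈ B 1`, `c ∈ C 1`, `a' ∈ A 1`.
[cite: CohnKleinbergSzegedyUmans2005, Def. 5.1] -/
theorem gB {b b' c a' : Fin 3 → ZMod n} (hb : b ∈ B 1) (hb' : b' ∈ B 1) (hc : c ∈ C 1)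
    (ha' : a' ∈ A 1) :
    (b - b' + (c - a')) 0 = 0 ∨ (b - b' + (c - a')) 2 = 0 ∨ (b - b' + (c - a')) 1 ≠ 0 := by
  have h01 : (0 : Fin 2) ≠ 1 := by decide
  refine not_N_of_avoid₂ (α := 0) (β := 2) (γ := 1) (by decide) (by decide) (by decide) (by decide)
    hA0 hC0 fun x hx z hz heq => h01 ?_
  exact (hS.2 0 1 1 x hx a' ha' b hb b' hb' c hc (-z) (Prop52Maximal.neg_mem_axis hC0 hz)
    (by rw [← heq]; abel)).1

omit hn hC0 in
/-- Pattern `(1,0,1)`: `(c − c') + (a − b') ∉ N₂` for `c, c' ∈ C 1`, `a ∈ A 1`, `b' ∈ B 1`.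
[cite: CohnKleinbergSzegedyUmans2005, Def. 5.1] -/
theorem gC {c c' a b' : Fin 3 → ZMod n} (hc : c ∈ C 1) (hc' : c' ∈ C 1) (ha : a ∈ A 1)
    (hb' : b' ∈ B 1) :
    (c - c' + (a - b')) 0 = 0 ∨ (c - c' + (a - b')) 1 = 0 ∨ (c - c' + (a - b')) 2 ≠ 0 := by
  have h10 : (1 : Fin 2) ≠ 0 := by decide
  refine not_N_of_avoid₂ (α := 0) (β := 1) (γ := 2) (by decide) (by decide) (by decide) (by decide)
    hA0 hB0 fun x hx y hy heq => h10 ?_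
  exact (hS.2 1 0 1 a ha (-x) (Prop52Maximal.neg_mem_axis hA0 hx) y hy b' hb' c hc c' hc'
    (by rw [← heq]; abel)).1

omit hn hA0 hB0 hC0 in
/-- Pattern `(1,1,1)` (the TPP of member `1`): `(a, b, c) ↦ a + b + c` is injective on
`A 1 × B 1 × C 1`. [cite: CohnKleinbergSzegedyUmans2005, Def. 5.1] -/
theorem sum_injective {a a' b b' c c' : Fin 3 → ZMod n} (ha : a ∈ A 1) (ha' : a' ∈ A 1)
    (hb : b ∈ B 1) (hb' : b' ∈ B 1) (hc : c ∈ C 1) (hc' : c' ∈ C 1)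
    (h : a + b + c = a' + b' + c') : a = a' ∧ b = b' ∧ c = c' :=
  hS.1 1 a ha a' ha' b hb b' hb' c hc c' hc' (by rw [← sub_eq_zero] at h; rw [← h]; abel)

end Constraints

end FatPartners

end Summit.MatrixMultiplication.MatrixMultiplication.Theorems
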